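import Mathlib
import Summits.Ventures.PercRepro2.SkeletonReduction

/-!
# The crux of record reduced to the reduced graphs (blind cell PercRepro2, night-1 g15;
NIGHT1-G15.md §5)

`CovForm.HCov_all R` — (HCOV) on every finite graph, the weighted crux of record — follows from
(HCOV) on the REDUCED instances (`Skeleton.Reduced`: every unmarked vertex without a nonzero loop
and of nonzero-degree `0` or `≥ 3`), by `Skeleton.HCov_of_reduced` on each `(E, V)`
(`HCov_all_of_reduced`).  The same for the mean-field row (`HMF_all_of_reduced`).
-/

namespace Summit.Ventures.PercRepro2

open CovForm

namespace Skeleton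

variable (R : Type*) [Field R] [LinearOrder R] [IsStrictOrderedRing R]

/-- **(HCOV) on the reduced instances**: the hypothesis of the skeleton reduction, quantified like
`CovForm.HCov_all`. -/
def HCov_reduced_all : Prop :=
  ∀ (V E : Type) [Fintype V] [DecidableEq V] [Fintype E] [DecidableEq E]
    (ends : E → Sym2 V) (p : E → R), IsProbVec p →
    ∀ o a₁ a₂ a₃ b : V, a₁ ≠ a₂ → a₁ ≠ a₃ → a₂ ≠ a₃ → o ≠ a₁ → o ≠ a₂ → o ≠ a₃ → o ≠ b →
      b ≠ a₁ → b ≠ a₂ → b ≠ a₃ → Reduced p ends o a₁ a₂ a₃ b → HCov p ends o a₁ a₂ a₃ b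

/-- **(HMF) on the reduced instances.** -/
def HMF_reduced_all : Prop :=
  ∀ (V E : Type) [Fintype V] [DecidableEq V] [Fintype E] [DecidableEq E]
    (ends : E → Sym2 V) (p : E → R), IsProbVec p →
    ∀ o a₁ a₂ a₃ b : V, a₁ ≠ a₂ → a₁ ≠ a₃ → a₂ ≠ a₃ → o ≠ a₁ → o ≠ a₂ → o ≠ a₃ → o ≠ b →
      b ≠ a₁ → b ≠ a₂ → b ≠ a₃ → Reduced p ends o a₁ a₂ a₃ b → HMF p ends o a₁ a₂ a₃ b

/-- **(HMF) on every finite graph** (labelling-free; the mean-field row quantified like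
`CovForm.HCov_all`). -/
def HMF_all : Prop :=
  ∀ (V E : Type) [Fintype V] [DecidableEq V] [Fintype E] [DecidableEq E]
    (ends : E → Sym2 V) (p : E → R), IsProbVec p →
    ∀ o a₁ a₂ a₃ b : V, a₁ ≠ a₂ → a₁ ≠ a₃ → a₂ ≠ a₃ → o ≠ a₁ → o ≠ a₂ → o ≠ a₃ → o ≠ b →
      b ≠ a₁ → b ≠ a₂ → b ≠ a₃ → HMF p ends o a₁ a₂ a₃ b

variable {R}

/-- **THE CRUX OF RECORD IS REDUCED TO THE REDUCED GRAPHS**: `HCov_all R` follows from (HCOV) on the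
instances whose unmarked vertices have degree `≥ 3` (or are isolated) and carry no nonzero loop. -/
theorem HCov_all_of_reduced (h : HCov_reduced_all R) : HCov_all R := by
  intro V E _ _ _ _ ends p hp o a₁ a₂ a₃ b h12 h13 h23 ho1 ho2 ho3 hob hb1 hb2 hb3
  exact HCov_of_reduced o a₁ a₂ a₃ b
    (fun p ends hp hred => h V E ends p hp o a₁ a₂ a₃ b h12 h13 h23 ho1 ho2 ho3 hob hb1 hb2 hb3 hred)
    p ends hp

/-- The mean-field row on every finite graph follows from the reduced instances. -/
theorem HMF_all_of_reduced (h : HMF_reduced_all R) : HMF_all R := by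
  intro V E _ _ _ _ ends p hp o a₁ a₂ a₃ b h12 h13 h23 ho1 ho2 ho3 hob hb1 hb2 hb3
  exact HMF_of_reduced o a₁ a₂ a₃ b
    (fun p ends hp hred => h V E ends p hp o a₁ a₂ a₃ b h12 h13 h23 ho1 ho2 ho3 hob hb1 hb2 hb3 hred)
    p ends hp

end Skeleton

end Summit.Ventures.PercRepro2
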